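import Summits.ABC.IUTFork.Repair.RH2SigmaHullExponent
import Summits.ABC.IUTFork.Repair.RHLinearReachLawMixedSigma
import HarnessLib

/-!
# R-H ROUND 2, row 20′ «tuple reach cell» × EXPONENT PROGRAMME F5 — the σ-INSTANCE AT `σ := Σ₂₀′(T)` WITH THE LICENCE BINDER DISCHARGED:
# «S|Σ₂₀′ is a THEOREM ⟹ abc WITH EXPONENT `1/μ₀` ON EVERY FAR-FROM-CUSPS FAMILY from the MASS hypothesis on Σ₂₀′ alone (+ the θ-cut cone / cone-free)»

PROOF-ONLY file (D-0012: 0 definitions, 0 `Prop` facts, no instance, no notation; abc-iut cell, rung LADDER-ABC:A2.RESCUE.H; seat abc-iut-rh-typ-7 gen 6,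
row-20 lineage; pattern = abc-iut-rh2-q2-hull's `Repair/RH2SigmaHullExponentRows.lean` (p487290: rows 18 and 15), which names THIS instance as the row-20′ lane's).
TAKES NO SIDE on [IUTchIII] Cor. 3.12 or on any author; nothing asserts abc proved or refuted; typed ≠ proved; instantiated ≠ endorsed.

THE POINT. abc-iut-rh2-T-1's F5 (a) endpoint (p485274 `Conditional.SigmaMass.abcExpOn_farFromCusps_of_licenceOn_mu_content_hregC`, cone-free twin
`…_szpiroBad_degOne`) reads, for a FREE stratum `σ(P,l,T)`: [LIC] «the (xi-f) licence holds on `σ`» · [MU] «`σ` retains `≥ μ₀·T.gap − Tol(P,l)` of the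
`(j²−1)`-mass» (· [CONE-C] `hregC`) ⟹ `∀ ρ ∈ (0,½], ABCWithExponentOn {λ ρ-far from the cusps} (1/μ₀)`. For ROW 20′'s DICTIONARY-FREE window
`Σ₂₀′(T) := RH.LinearReachLaw.sigmaReachMix (pilotDataOfK T.D T.K)` (companion p488728: the cells `(i, p)` at which the mixed reach cell `CellReachMixAt`, p476752,
holds on every bad-last summand; decided from the columns on untied rows by `cellReachMixAt_pilotDataOfK_iff_col_of_not_dvd`, p479634) [LIC] is a THEOREM
(`licenceOn_sigmaReachMix_chosen`), so: §E1 the mass order `B_triv(Σ_licᶜ) ≤ B_triv(Σ₂₀′ᶜ) ≤ B_triv(Σ₁₅ᶜ)` at one datum (Σ₂₀′ ⊆ Σ_lic; Σ₁₅ ⊆ Σ₂₀′ under row 15's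
three certificate binders, `sigmaSlotReach_subset_sigmaReachMix_pilotDataOfK`); §E2 the two σ-instances `abcExpOn_farFromCusps_of_mu_sigma20_content_hregC`
(explicit 2 = [MU-C at Σ₂₀′]·[CONE-C]) and `…_sigma20_szpiroBad_degOne` (CONE-FREE explicit 1 = [MU₁-bad at Σ₂₀′] ALONE: «if at every genuine Θ-volume datum of
every Szpiro-bad admissible RATIONAL `(λ, l)` the tuple-reach cells retain `≥ μ₀·gap − Tol` of the `(j²−1)`-mass, then abc with exponent `1/μ₀` on every
far-from-cusps family»); §E3 `hMu20_of_hMu15_content` / `…_szpiroBad_degOne` — row 15's mass binders (p487290 §2) IMPLY row 20′'s datum by datum, so among the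
per-row instances of the hull-reach family («15 ⊋ 8, 16, 18; + 20») the Σ₂₀′ instance carries the WEAKEST mass hypothesis (only `σ := Σ_lic` is weaker).
BINDER STATUS (numbers, names; no side). The content-cut forms engage NO tabulated datum (rh-lead B23: every table misses the content locus by `≥ 7·10⁶`); the
cone-free Szpiro-bad forms ARE engaged at the tier-1 Frey–Legendre data (p480214), where Σ₂₀′'s mass fraction is a NUMERIC of record (Σ₂₀′ = Σ₂₀ on rational beds;
exact reach cell pooled `52.1 %` v1-scope, abc-iut-rh-num-1 HULL-REACH-K1), not a theorem — undecided as typed; at each datum [MU] holds for free at `μ₀ := μ₂₀′(T)`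
(abc-iut-rh2-w-1 `offSigmaTolerance_offTrivialMass_massFrac_chosen`). «Follows AS TYPED», nothing more.
[claim: Mochizuki2012, status: disputed] [cite: Mochizuki2012, IUTchIII Thm. 3.11 (i) (Ind2) p. 154, Cor. 3.12 p. 173–174, Step (xi-f) p. 184; IUTchIV Thm. 1.10
pp. 22–31, Cor. 2.2 (ii)–(iii) pp. 41–48] [cite: MochizukiGenEll2010, Thm 2.1 p.11–12] [cite: DupuyHilado2025, §3.3, §3.4, §3.9, §4.9]
-/

noncomputable section

open Set Function
namespace Summit.ABC.IUTFork.Repair.RH.LinearReachLaw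

open Thm311 Thm311.Real Cor312 Cor312.Setting Cor312Vol Cor312Prov Literature.IUT.LogThetaLattice Literature.IUT.LogVolume
  Literature.IUT.HodgeTheaters Literature.IUT.LogVolume.ThetaData
open Literature.NumberTheory.NumberFields NumberField IsDedekindDomain Metric RHSlotReach RH RH.InSigmaDatum RH.SigmaLicence RH.SigmaMass RH.OffSigma
open Literature.NumberTheory.DiophantineGeometry Literature.NumberTheory.DiophantineGeometry.GenEll Summit.ABC.ABC.Theorems Conditional Conditional.SigmaMass
open Summit.ABC.IUTFork.Repair.RH2SigmaHull

/-! ## §E1. One genuine datum, CHOSEN realising ideles: the mass order `B_triv(Σ_licᶜ) ≤ B_triv(Σ₂₀′ᶜ) ≤ B_triv(Σ₁₅ᶜ)` -/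
section Datum
variable {F K Fbar : Type} [Field F] [NumberField F] [Field K] [NumberField K] [Algebra F K] [Field Fbar]
  [Algebra F Fbar] [Algebra K Fbar] {E : WeierstrassCurve F} [E.IsElliptic] {l : ℕ} {Pb : BadPlacePredicates K}
  (D : InitialThetaData F K Fbar E l Pb)
  (M : Type) [Field M] [NumberField M]
  (archPk : ∀ (j : (thetaIndex (pilotDataOfK D K)).Label) (vQ : (thetaIndex (pilotDataOfK D K)).VQ),
    Set ((logShellsDH (pilotDataOfK D K) (analyticLogv K)).Packet j vQ))
  (archSub : ∀ (j : (thetaIndex (pilotDataOfK D K)).Label) (v : (thetaIndex (pilotDataOfK D K)).V),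
    Set ((logShellsDH (pilotDataOfK D K) (analyticLogv K)).Packet j ((thetaIndex (pilotDataOfK D K)).over v)))
  (Ψ : ℤ → ∀ v : (thetaIndex (pilotDataOfK D K)).V, v ∈ (thetaIndex (pilotDataOfK D K)).Vbad →
    Set ((logShellsDH (pilotDataOfK D K) (analyticLogv K)).StarPacket v))
  (act : ℤ → ∀ v : (thetaIndex (pilotDataOfK D K)).V, v ∈ (thetaIndex (pilotDataOfK D K)).Vbad →
    (logShellsDH (pilotDataOfK D K) (analyticLogv K)).StarPacket v →
      Module.End ℚ ((logShellsDH (pilotDataOfK D K) (analyticLogv K)).StarPacket v))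
  (Mmod : ℤ → ∀ j : (thetaIndex (pilotDataOfK D K)).LabelStar, Set ((logShellsDH (pilotDataOfK D K) (analyticLogv K)).GlobalPacket j.1))
  (region : ℤ → ∀ j : (thetaIndex (pilotDataOfK D K)).LabelStar, FinDivisor M → ∀ vQ : (thetaIndex (pilotDataOfK D K)).VQ,
    Set ((logShellsDH (pilotDataOfK D K) (analyticLogv K)).Packet j.1 vQ))
  (n : ℤ) {HT : Type} {LogLink : HT → HT → Type} {IsFull : ∀ {s t : HT}, LogLink s t → Prop}
  (lat : LGPGaussianLogThetaLattice LogLink IsFull)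
  {Frd : Type} {IsoF : Frd → Frd → Type} {Ob : Frd → Type} {realify : Frd → Frd} {Strip : Type}
  {IsoS : Strip → Strip → Type}
  {Mv : ∀ v : (thetaIndex (pilotDataOfK D K)).V, v ∈ (thetaIndex (pilotDataOfK D K)).Vbad → Type} [∀ v h, Monoid (Mv v h)]
  (sig : GlobalLGPFrobenioidSignature (thetaIndex (pilotDataOfK D K)).lstar (thetaIndex (pilotDataOfK D K)).V
    (· ∈ (thetaIndex (pilotDataOfK D K)).Vbad) Frd IsoF Ob realify Strip IsoS Mv)
  (split : SplittingMonoids Mv) {ObΔ : Type}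
  {N : ∀ v : (thetaIndex (pilotDataOfK D K)).V, v ∈ (thetaIndex (pilotDataOfK D K)).Vbad → Type} [∀ v h, Monoid (N v h)]
  (qData : QPilotData ObΔ N)

/-- **Σ_lic DISCARDS LEAST, AT Σ₂₀′.** At the genuine bed with the chosen realising ideles, `B_triv(Σ_lic(T)ᶜ) ≤ B_triv(Σ₂₀′(T)ᶜ)`: abc-iut-rh2-q2-hull's
`offTrivialMass_licenceCells_le_of_licenceOn_chosen` at the licensed stratum `σ := Σ₂₀′` (`licenceOn_sigmaReachMix_chosen`). [claim: Mochizuki2012, status: disputed] -/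
theorem offTrivialMass_licenceCells_le_sigmaReachMix_chosen :
    offTrivialMass (settingPrVolSharp (pilotDataOfK D K) (logvAnalytic_analyticLogv (F := K)) M archPk archSub Ψ act Mmod region n lat sig split qData
        (exists_realising_qIdeles_pilotDataOfK D).choose (exists_realising_thetaIdeles_pilotDataOfK D).choose
        (exists_realising_qIdeles_pilotDataOfK D).choose_spec.1 (exists_realising_qIdeles_pilotDataOfK D).choose_spec.2.1)
      (licenceCells (settingPrVolSharp (pilotDataOfK D K) (logvAnalytic_analyticLogv (F := K)) M archPk archSub Ψ act Mmod region n lat sig split qData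
        (exists_realising_qIdeles_pilotDataOfK D).choose (exists_realising_thetaIdeles_pilotDataOfK D).choose
        (exists_realising_qIdeles_pilotDataOfK D).choose_spec.1 (exists_realising_qIdeles_pilotDataOfK D).choose_spec.2.1)) ≤
    offTrivialMass (settingPrVolSharp (pilotDataOfK D K) (logvAnalytic_analyticLogv (F := K)) M archPk archSub Ψ act Mmod region n lat sig split qData
        (exists_realising_qIdeles_pilotDataOfK D).choose (exists_realising_thetaIdeles_pilotDataOfK D).choose
        (exists_realising_qIdeles_pilotDataOfK D).choose_spec.1 (exists_realising_qIdeles_pilotDataOfK D).choose_spec.2.1)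
      (sigmaReachMix (pilotDataOfK D K)) :=
  offTrivialMass_licenceCells_le_of_licenceOn_chosen D M archPk archSub Ψ act Mmod region n lat sig split qData _
    (licenceOn_sigmaReachMix_chosen D M archPk archSub Ψ act Mmod region n lat sig split qData)

/-- **Σ₂₀′ DISCARDS NO MORE THAN ANY CERTIFIED Σ₁₅.** At the genuine bed with the chosen realising ideles, for every CERTIFIED window dictionary `(n₀, λ, m_q)`
of row 15 (inner certificates `hn₀`, outer certificates `hlam`, integer Kummer orders `hmq`), `B_triv(Σ₂₀′(T)ᶜ) ≤ B_triv(Σ₁₅(T; n₀, λ, m_q)ᶜ)`: the companion's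
`sigmaSlotReach_subset_sigmaReachMix_pilotDataOfK` through abc-iut-rh2-T-1's `offTrivialMass_anti` (bridge hypotheses are theorems here). [claim: Mochizuki2012, status: disputed] -/
theorem offTrivialMass_sigmaReachMix_le_sigmaSlotReach_chosen
    (n₀ : ∀ pp : Nat.Primes, (thetaIndex (pilotDataOfK D K)).Fibre (.inr pp) → ℕ)
    (lam : ∀ pp : Nat.Primes, (thetaIndex (pilotDataOfK D K)).Fibre (.inr pp) → ℝ)
    (mq : ∀ pp : Nat.Primes, (thetaIndex (pilotDataOfK D K)).Fibre (.inr pp) → ℤ)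
    (hn₀ : ∀ (pp : Nat.Primes) (x : (thetaIndex (pilotDataOfK D K)).Fibre (.inr pp)), haveI : Fact (pp : ℕ).Prime := ⟨pp.2⟩
      ∃ u : kOf (pilotDataOfK D K) pp.1 x,
        ‖u‖ ≤ (pp : ℝ) ^ (-(((n₀ pp x : ℤ) - 1 : ℤ) : ℝ) / (ramIdx K (placeOf (pilotDataOfK D K) pp.1 x) : ℝ)) ∧
          u ∉ (logUnits (kOf (pilotDataOfK D K) pp.1 x) : Set (kOf (pilotDataOfK D K) pp.1 x)))
    (hlam : ∀ (pp : Nat.Primes) (x : (thetaIndex (pilotDataOfK D K)).Fibre (.inr pp)), haveI : Fact (pp : ℕ).Prime := ⟨pp.2⟩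
      ∃ z ∈ (logUnits (kOf (pilotDataOfK D K) pp.1 x) : Set (kOf (pilotDataOfK D K) pp.1 x)), (pp : ℝ) ^ (lam pp x) ≤ ‖z‖)
    (hmq : ∀ (pp : Nat.Primes) (w : (thetaIndex (pilotDataOfK D K)).Fibre (.inr pp)), haveI : Fact (pp : ℕ).Prime := ⟨pp.2⟩
      placeOf (pilotDataOfK D K) pp.1 w ∈ (pilotDataOfK D K).S →
        (mq pp w : ℝ) = (pilotDataOfK D K).qPilot (placeOf (pilotDataOfK D K) pp.1 w)) :
    offTrivialMass (settingPrVolSharp (pilotDataOfK D K) (logvAnalytic_analyticLogv (F := K)) M archPk archSub Ψ act Mmod region n lat sig split qData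
        (exists_realising_qIdeles_pilotDataOfK D).choose (exists_realising_thetaIdeles_pilotDataOfK D).choose
        (exists_realising_qIdeles_pilotDataOfK D).choose_spec.1 (exists_realising_qIdeles_pilotDataOfK D).choose_spec.2.1)
      (sigmaReachMix (pilotDataOfK D K)) ≤
    offTrivialMass (settingPrVolSharp (pilotDataOfK D K) (logvAnalytic_analyticLogv (F := K)) M archPk archSub Ψ act Mmod region n lat sig split qData
        (exists_realising_qIdeles_pilotDataOfK D).choose (exists_realising_thetaIdeles_pilotDataOfK D).choose
        (exists_realising_qIdeles_pilotDataOfK D).choose_spec.1 (exists_realising_qIdeles_pilotDataOfK D).choose_spec.2.1)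
      (sigmaSlotReach (pilotDataOfK D K) (fun pp x => haveI : Fact (pp : ℕ).Prime := ⟨pp.2⟩; ramIdx K (placeOf (pilotDataOfK D K) pp.1 x)) n₀ lam
        (fun pp i w => ((((i : ℕ) : ℤ) + 1) ^ 2) * mq pp w) mq) :=
  offTrivialMass_anti
    (bridgeHyps_settingPrVolSharp_of_ideles (pilotDataOfK D K) (logvAnalytic_analyticLogv (F := K)) M archPk archSub Ψ act Mmod region n lat sig
      split qData (exists_realising_thetaIdeles_pilotDataOfK D).choose (exists_realising_qIdeles_pilotDataOfK D).choose
      (exists_realising_thetaIdeles_pilotDataOfK D).choose_spec.1 (exists_realising_thetaIdeles_pilotDataOfK D).choose_spec.2.1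
      (exists_realising_qIdeles_pilotDataOfK D).choose_spec.1 (exists_realising_qIdeles_pilotDataOfK D).choose_spec.2.1)
    (sigmaSlotReach_subset_sigmaReachMix_pilotDataOfK D n₀ lam mq hn₀ hlam hmq)

end Datum
/-! ## §E2. The F5 σ-instances at `σ := Σ₂₀′(T)` — licence binder DISCHARGED, the mass binder on Σ₂₀′ the only Σ-hypothesis -/
section Rows
variable (M : ∀ (P : NFPoint) (l : ℕ) (T : Cor22.ThetaVolumeDatumAt P l), Type) [∀ P l T, Field (M P l T)] [∀ P l T, NumberField (M P l T)]
    (archPk : ∀ (P : NFPoint) (l : ℕ) (T : Cor22.ThetaVolumeDatumAt P l), letI := T.instFieldF; letI := T.instNumberFieldF; letI := T.instAlgebraF; letI := T.instFieldK;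
        letI := T.instNumberFieldK; letI := T.instAlgebraK; letI := T.instFieldFbar; letI := T.instAlgebraFbar;
        letI := T.instAlgebraKFbar; letI := T.instIsElliptic;
      ∀ (j : (thetaIndex (pilotDataOfK T.D T.K)).Label) (vQ : (thetaIndex (pilotDataOfK T.D T.K)).VQ), Set ((logShellsDH (pilotDataOfK T.D T.K) (analyticLogv T.K)).Packet j vQ))
    (archSub : ∀ (P : NFPoint) (l : ℕ) (T : Cor22.ThetaVolumeDatumAt P l), letI := T.instFieldF; letI := T.instNumberFieldF; letI := T.instAlgebraF; letI := T.instFieldK;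
        letI := T.instNumberFieldK; letI := T.instAlgebraK; letI := T.instFieldFbar; letI := T.instAlgebraFbar;
        letI := T.instAlgebraKFbar; letI := T.instIsElliptic;
      ∀ (j : (thetaIndex (pilotDataOfK T.D T.K)).Label) (v : (thetaIndex (pilotDataOfK T.D T.K)).V), Set ((logShellsDH (pilotDataOfK T.D T.K) (analyticLogv T.K)).Packet j ((thetaIndex (pilotDataOfK T.D T.K)).over v)))
    (Ψ : ∀ (P : NFPoint) (l : ℕ) (T : Cor22.ThetaVolumeDatumAt P l), letI := T.instFieldF; letI := T.instNumberFieldF; letI := T.instAlgebraF; letI := T.instFieldK;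
        letI := T.instNumberFieldK; letI := T.instAlgebraK; letI := T.instFieldFbar; letI := T.instAlgebraFbar;
        letI := T.instAlgebraKFbar; letI := T.instIsElliptic;
      ℤ → ∀ v : (thetaIndex (pilotDataOfK T.D T.K)).V, v ∈ (thetaIndex (pilotDataOfK T.D T.K)).Vbad → Set ((logShellsDH (pilotDataOfK T.D T.K) (analyticLogv T.K)).StarPacket v))
    (act : ∀ (P : NFPoint) (l : ℕ) (T : Cor22.ThetaVolumeDatumAt P l), letI := T.instFieldF; letI := T.instNumberFieldF; letI := T.instAlgebraF; letI := T.instFieldK;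
        letI := T.instNumberFieldK; letI := T.instAlgebraK; letI := T.instFieldFbar; letI := T.instAlgebraFbar;
        letI := T.instAlgebraKFbar; letI := T.instIsElliptic;
      ℤ → ∀ v : (thetaIndex (pilotDataOfK T.D T.K)).V, v ∈ (thetaIndex (pilotDataOfK T.D T.K)).Vbad → (logShellsDH (pilotDataOfK T.D T.K) (analyticLogv T.K)).StarPacket v → Module.End ℚ ((logShellsDH (pilotDataOfK T.D T.K) (analyticLogv T.K)).StarPacket v))
    (Mmod : ∀ (P : NFPoint) (l : ℕ) (T : Cor22.ThetaVolumeDatumAt P l), letI := T.instFieldF; letI := T.instNumberFieldF; letI := T.instAlgebraF; letI := T.instFieldK;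
        letI := T.instNumberFieldK; letI := T.instAlgebraK; letI := T.instFieldFbar; letI := T.instAlgebraFbar;
        letI := T.instAlgebraKFbar; letI := T.instIsElliptic;
      ℤ → ∀ j : (thetaIndex (pilotDataOfK T.D T.K)).LabelStar, Set ((logShellsDH (pilotDataOfK T.D T.K) (analyticLogv T.K)).GlobalPacket j.1))
    (region : ∀ (P : NFPoint) (l : ℕ) (T : Cor22.ThetaVolumeDatumAt P l), letI := T.instFieldF; letI := T.instNumberFieldF; letI := T.instAlgebraF; letI := T.instFieldK;
        letI := T.instNumberFieldK; letI := T.instAlgebraK; letI := T.instFieldFbar; letI := T.instAlgebraFbar;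
        letI := T.instAlgebraKFbar; letI := T.instIsElliptic;
      ℤ → ∀ j : (thetaIndex (pilotDataOfK T.D T.K)).LabelStar, FinDivisor (M P l T) → ∀ vQ : (thetaIndex (pilotDataOfK T.D T.K)).VQ, Set ((logShellsDH (pilotDataOfK T.D T.K) (analyticLogv T.K)).Packet j.1 vQ))
    (n : ∀ (P : NFPoint) (l : ℕ) (T : Cor22.ThetaVolumeDatumAt P l), ℤ)
    {HT : ∀ (P : NFPoint) (l : ℕ) (T : Cor22.ThetaVolumeDatumAt P l), Type} {LogLink : ∀ (P : NFPoint) (l : ℕ) (T : Cor22.ThetaVolumeDatumAt P l), HT P l T → HT P l T → Type}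
    {IsFull : ∀ (P : NFPoint) (l : ℕ) (T : Cor22.ThetaVolumeDatumAt P l), ∀ {s t : HT P l T}, LogLink P l T s t → Prop}
    (lat : ∀ (P : NFPoint) (l : ℕ) (T : Cor22.ThetaVolumeDatumAt P l), LGPGaussianLogThetaLattice (LogLink P l T) (IsFull P l T))
    {Frd : ∀ (P : NFPoint) (l : ℕ) (T : Cor22.ThetaVolumeDatumAt P l), Type} {IsoF : ∀ (P : NFPoint) (l : ℕ) (T : Cor22.ThetaVolumeDatumAt P l), Frd P l T → Frd P l T → Type} {Ob : ∀ (P : NFPoint) (l : ℕ) (T : Cor22.ThetaVolumeDatumAt P l), Frd P l T → Type}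
    {realify : ∀ (P : NFPoint) (l : ℕ) (T : Cor22.ThetaVolumeDatumAt P l), Frd P l T → Frd P l T} {Strip : ∀ (P : NFPoint) (l : ℕ) (T : Cor22.ThetaVolumeDatumAt P l), Type} {IsoS : ∀ (P : NFPoint) (l : ℕ) (T : Cor22.ThetaVolumeDatumAt P l), Strip P l T → Strip P l T → Type}
    {Mv : ∀ (P : NFPoint) (l : ℕ) (T : Cor22.ThetaVolumeDatumAt P l), letI := T.instFieldF; letI := T.instNumberFieldF; letI := T.instAlgebraF; letI := T.instFieldK;
        letI := T.instNumberFieldK; letI := T.instAlgebraK; letI := T.instFieldFbar; letI := T.instAlgebraFbar;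
        letI := T.instAlgebraKFbar; letI := T.instIsElliptic;
      ∀ v : (thetaIndex (pilotDataOfK T.D T.K)).V, v ∈ (thetaIndex (pilotDataOfK T.D T.K)).Vbad → Type}
    [∀ P l T v h, Monoid (Mv P l T v h)]
    (sig : ∀ (P : NFPoint) (l : ℕ) (T : Cor22.ThetaVolumeDatumAt P l), letI := T.instFieldF; letI := T.instNumberFieldF; letI := T.instAlgebraF; letI := T.instFieldK;
        letI := T.instNumberFieldK; letI := T.instAlgebraK; letI := T.instFieldFbar; letI := T.instAlgebraFbar;
        letI := T.instAlgebraKFbar; letI := T.instIsElliptic;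
      GlobalLGPFrobenioidSignature (thetaIndex (pilotDataOfK T.D T.K)).lstar (thetaIndex (pilotDataOfK T.D T.K)).V (· ∈ (thetaIndex (pilotDataOfK T.D T.K)).Vbad) (Frd P l T) (IsoF P l T) (Ob P l T) (realify P l T)
        (Strip P l T) (IsoS P l T) (Mv P l T))
    (split : ∀ (P : NFPoint) (l : ℕ) (T : Cor22.ThetaVolumeDatumAt P l), SplittingMonoids (Mv P l T))
    {ObΔ : ∀ (P : NFPoint) (l : ℕ) (T : Cor22.ThetaVolumeDatumAt P l), Type} {N : ∀ (P : NFPoint) (l : ℕ) (T : Cor22.ThetaVolumeDatumAt P l), letI := T.instFieldF; letI := T.instNumberFieldF; letI := T.instAlgebraF; letI := T.instFieldK;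
        letI := T.instNumberFieldK; letI := T.instAlgebraK; letI := T.instFieldFbar; letI := T.instAlgebraFbar;
        letI := T.instAlgebraKFbar; letI := T.instIsElliptic;
      ∀ v : (thetaIndex (pilotDataOfK T.D T.K)).V, v ∈ (thetaIndex (pilotDataOfK T.D T.K)).Vbad → Type}
    [∀ P l T v h, Monoid (N P l T v h)] (qData : ∀ (P : NFPoint) (l : ℕ) (T : Cor22.ThetaVolumeDatumAt P l), QPilotData (ObΔ P l T) (N P l T))

/-- **`abcExpOn_farFromCusps_of_mu_sigma20_content_hregC` — F5 (a) AT ROW 20′'s Σ₂₀′, LICENCE DISCHARGED.** Explicit 2 = [MU-C at Σ₂₀′] 1 · [CONE-C] 1: for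
`μ₀ ∈ (0, 1]`, IF at every admissible `(P, l)` on the content locus «`6·(1 + 20·d_mod/l)·(log-diff + log-cond) + 120·d*·l < log q^{∤{2,l}}`» and every genuine
Θ-volume datum `T` the tuple-reach cells `Σ₂₀′(T) := sigmaReachMix (pilotDataOfK T.D T.K)` (DICTIONARY-FREE) retain the mass, `B_triv(Σ₂₀′(T)ᶜ) ≤ (1−μ₀)·T.gap + Tol(P,l)`
(abc-iut-rh2-xi-1's `OffSigmaTolerance` VERBATIM), and [CONE-C] `hregC` (abc-iut-C-cert-1's binder VERBATIM), THEN for every `ρ ∈ (0, 1/2]`: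
**`ABCWithExponentOn {λ | λ ρ-far from the cusps at ∞ and 2} (1/μ₀)`**. PROOF = abc-iut-rh2-T-1's p485274 at `σ := Σ₂₀′` with [LIC-C] := the companion's
`licenceOn_sigmaReachMix_chosen`. CONDITIONAL; the mass binder engages no tabulated datum (content locus); «follows AS TYPED», nothing more; no side taken on
[IUTchIII] Cor. 3.12 or on any author. [cite: Mochizuki2012, IUTchIV Thm. 1.10 pp. 22–31; Cor. 2.2 (ii)–(iii) pp. 41–48] [cite: MochizukiGenEll2010, Thm 2.1 p.11–12]
[cite: DupuyHilado2025, §3.9, §4.9] [claim: Mochizuki2012, status: disputed] -/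
theorem abcExpOn_farFromCusps_of_mu_sigma20_content_hregC {μ₀ : ℝ} (hμ₀ : 0 < μ₀) (hμ₁ : μ₀ ≤ 1)
    -- [MU-C at Σ₂₀′] the tuple-reach cells retain `≥ μ₀·T.gap − Tol(P,l)` of the mass at every content-locus datum
    (hMu20 : ∀ P : NFPoint, P ∈ UP → ∀ l : ℕ, l.Prime → 5 ≤ l →
      Cor22.AdmitsCore P → Cor22.CondP2 P l → Cor22.CondP5 P l → Cor22.CondP6 P l →
      6 * ((1 + 20 * (Cor22.dmod P : ℝ) / l) * (P.logDiff + Cor22.logCondAvoid P {2, l}))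
          + 120 * (2 ^ 12 * 3 ^ 3 * 5 * (Cor22.dmod P : ℝ) * l) < Cor22.logQAvoid P {2, l} →
      ∀ T : Cor22.ThetaVolumeDatumAt P l, letI := T.instFieldF; letI := T.instNumberFieldF; letI := T.instAlgebraF; letI := T.instFieldK;
        letI := T.instNumberFieldK; letI := T.instAlgebraK; letI := T.instFieldFbar; letI := T.instAlgebraFbar;
        letI := T.instAlgebraKFbar; letI := T.instIsElliptic;
      OffSigmaTolerance (1 - μ₀) (tol P l) T
        (offTrivialMass
          (settingPrVolSharp (pilotDataOfK T.D T.K) (logvAnalytic_analyticLogv (F := T.K)) (M P l T) (archPk P l T) (archSub P l T) (Ψ P l T)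
          (act P l T) (Mmod P l T) (region P l T) (n P l T) (lat P l T) (sig P l T) (split P l T) (qData P l T)
          (exists_realising_qIdeles_pilotDataOfK T.D).choose
          (exists_realising_thetaIdeles_pilotDataOfK T.D).choose
          (exists_realising_qIdeles_pilotDataOfK T.D).choose_spec.1
          (exists_realising_qIdeles_pilotDataOfK T.D).choose_spec.2.1)
          (sigmaReachMix (pilotDataOfK T.D T.K))))
    -- [CONE-C] abc-iut-C-cert-1's `hregC` VERBATIM
    (hregC : ∀ P : NFPoint, P ∈ UP → ∀ l : ℕ, l.Prime → 5 ≤ l →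
      Cor22.AdmitsCore P → Cor22.CondP2 P l → Cor22.CondP5 P l → Cor22.CondP6 P l →
      6 * ((1 + 20 * (Cor22.dmod P : ℝ) / l) * (P.logDiff + Cor22.logCondAvoid P {2, l}))
          + 120 * (2 ^ 12 * 3 ^ 3 * 5 * (Cor22.dmod P : ℝ) * l) < Cor22.logQAvoid P {2, l} →
      ∀ T : Cor22.ThetaVolumeDatumAt P l,
        (letI := T.instFieldF; letI := T.instNumberFieldF; letI := T.instAlgebraF; letI := T.instFieldK
         letI := T.instNumberFieldK; letI := T.instAlgebraK; letI := T.instFieldFbar; letI := T.instAlgebraFbar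
         letI := T.instAlgebraKFbar; letI := T.instIsElliptic
         ¬ (∀ p ∈ T.I.supportPrimes, ∀ v w : placesOver (fieldOfModuli T.E) p,
            (Summit.ABC.IUTFork.DHData.ofInput T.I).logQloc p v = (Summit.ABC.IUTFork.DHData.ofInput T.I).logQloc p w)) →
        T.HullEstimateOf
          (((l : ℝ) + 1) / 4 *
            ((1 + 12 * (Cor22.dmod P : ℝ) / l) * (P.logDiff + Cor22.logCondAvoid P {2, l})
              + 2 * Real.log l + 52
              + 20 / 3 * Real.log (((2 ^ 12 * 3 ^ 3 * 5 * Cor22.dmod P : ℕ) : ℝ) * (l : ℝ))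
                * (Nat.primeCounting (2 ^ 12 * 3 ^ 3 * 5 * Cor22.dmod P * l) : ℝ))))
    {ρ : ℝ} (h0 : 0 < ρ) (h2 : ρ ≤ 1 / 2) :
    ABCWithExponentOn {P : NFPoint | P.FarFromCusps ({2} : Finset ℕ) ρ} (1 / μ₀) :=
  abcExpOn_farFromCusps_of_licenceOn_mu_content_hregC hμ₀ hμ₁ M archPk archSub Ψ act Mmod region n lat sig split qData
    (fun P l T => letI := T.instFieldF; letI := T.instNumberFieldF; letI := T.instAlgebraF; letI := T.instFieldK;
        letI := T.instNumberFieldK; letI := T.instAlgebraK; letI := T.instFieldFbar; letI := T.instAlgebraFbar;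
        letI := T.instAlgebraKFbar; letI := T.instIsElliptic;
      sigmaReachMix (pilotDataOfK T.D T.K))
    (fun P _ l _ _ _ _ _ _ _ T => by
      letI := T.instFieldF; letI := T.instNumberFieldF; letI := T.instAlgebraF; letI := T.instFieldK
      letI := T.instNumberFieldK; letI := T.instAlgebraK; letI := T.instFieldFbar; letI := T.instAlgebraFbar
      letI := T.instAlgebraKFbar; letI := T.instIsElliptic
      exact licenceOn_sigmaReachMix_chosen T.D (M P l T) (archPk P l T) (archSub P l T) (Ψ P l T) (act P l T) (Mmod P l T) (region P l T)
          (n P l T) (lat P l T) (sig P l T) (split P l T) (qData P l T))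
    hMu20 hregC h0 h2

/-- **`abcExpOn_farFromCusps_of_mu_sigma20_szpiroBad_degOne` — F5 (a) CONE-FREE AT ROW 20′'s Σ₂₀′: ONE HYPOTHESIS.** Explicit 1 = [MU₁-bad at Σ₂₀′]: for
`μ₀ ∈ (0, 1]`, IF at every SZPIRO-BAD admissible RATIONAL `(P, l)` (guard of `Cor22.forall_cor312Of_of_szpiroBad` VERBATIM) and every genuine Θ-volume datum `T`
the tuple-reach cells `Σ₂₀′(T)` retain `≥ μ₀·T.gap − Tol(P,l)` of the `(j²−1)`-mass, THEN for every `ρ ∈ (0, 1/2]`: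
**`ABCWithExponentOn {λ ρ-far from the cusps at ∞, 2} (1/μ₀)`** — «S|Σ₂₀′ ⟹ abc with exponent `1/μ₀`» with S|Σ₂₀′ a THEOREM (p485274 §2 at `σ := Σ₂₀′`,
[LIC₁-bad] := `licenceOn_sigmaReachMix_chosen`). HONEST STATUS: engaged at the tier-1 Frey–Legendre data (p480214); there Σ₂₀′ = Σ₂₀ (rational beds are
fibre-homogeneous) is DECIDED from the columns on untied rows (`cellReachMixAt_pilotDataOfK_iff_col_of_not_dvd`) and its mass fraction is a NUMERIC of record,
not a theorem — undecided as typed; at each datum the binder holds at the datum's own Σ₂₀′ mass fraction for free (abc-iut-rh2-w-1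
`offSigmaTolerance_offTrivialMass_massFrac_chosen`). CONDITIONAL; no side taken on [IUTchIII] Cor. 3.12 or on any author. [cite: Mochizuki2012, IUTchIV Cor. 2.2
(ii)–(iii) pp. 41–48] [cite: DupuyHilado2025, §3.9, §4.9] [claim: Mochizuki2012, status: disputed] -/
theorem abcExpOn_farFromCusps_of_mu_sigma20_szpiroBad_degOne {μ₀ : ℝ} (hμ₀ : 0 < μ₀) (hμ₁ : μ₀ ≤ 1)
    -- [MU₁-bad at Σ₂₀′] the tuple-reach cells retain `≥ μ₀·T.gap − Tol(P,l)` of the mass at every Szpiro-bad admissible RATIONAL datum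
    (hMu20₁ : ∀ P : NFPoint, P ∈ UP → P.degree ≤ 1 → ∀ l : ℕ, l.Prime → 5 ≤ l →
      Cor22.AdmitsCore P → Cor22.CondP2 P l → Cor22.CondP5 P l → Cor22.CondP6 P l →
      (((l : ℝ) + 5) / 4 < (Cor22.dmod P : ℝ) ∨
        6 * l * (((l : ℝ) + 5) - 4 * Cor22.dmod P) / (((l : ℝ) + 4) * ((l : ℝ) - 3))
            * (P.logDiff + (1 - 1 / (l : ℝ)) * Cor22.logCondAvoid P {2, l})
          + 6 * l * ((l : ℝ) + 5) / (((l : ℝ) + 4) * ((l : ℝ) - 3)) * Real.log Real.pi < Cor22.logQAvoid P {2, l}) →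
      ∀ T : Cor22.ThetaVolumeDatumAt P l, letI := T.instFieldF; letI := T.instNumberFieldF; letI := T.instAlgebraF; letI := T.instFieldK;
        letI := T.instNumberFieldK; letI := T.instAlgebraK; letI := T.instFieldFbar; letI := T.instAlgebraFbar;
        letI := T.instAlgebraKFbar; letI := T.instIsElliptic;
      OffSigmaTolerance (1 - μ₀) (tol P l) T
        (offTrivialMass
          (settingPrVolSharp (pilotDataOfK T.D T.K) (logvAnalytic_analyticLogv (F := T.K)) (M P l T) (archPk P l T) (archSub P l T) (Ψ P l T)
          (act P l T) (Mmod P l T) (region P l T) (n P l T) (lat P l T) (sig P l T) (split P l T) (qData P l T)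
          (exists_realising_qIdeles_pilotDataOfK T.D).choose
          (exists_realising_thetaIdeles_pilotDataOfK T.D).choose
          (exists_realising_qIdeles_pilotDataOfK T.D).choose_spec.1
          (exists_realising_qIdeles_pilotDataOfK T.D).choose_spec.2.1)
          (sigmaReachMix (pilotDataOfK T.D T.K))))
    {ρ : ℝ} (h0 : 0 < ρ) (h2 : ρ ≤ 1 / 2) :
    ABCWithExponentOn {P : NFPoint | P.FarFromCusps ({2} : Finset ℕ) ρ} (1 / μ₀) :=
  abcExpOn_farFromCusps_of_licenceOn_mu_szpiroBad_degOne hμ₀ hμ₁ M archPk archSub Ψ act Mmod region n lat sig split qData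
    (fun P l T => letI := T.instFieldF; letI := T.instNumberFieldF; letI := T.instAlgebraF; letI := T.instFieldK;
        letI := T.instNumberFieldK; letI := T.instAlgebraK; letI := T.instFieldFbar; letI := T.instAlgebraFbar;
        letI := T.instAlgebraKFbar; letI := T.instIsElliptic;
      sigmaReachMix (pilotDataOfK T.D T.K))
    (fun P _ _ l _ _ _ _ _ _ _ T => by
      letI := T.instFieldF; letI := T.instNumberFieldF; letI := T.instAlgebraF; letI := T.instFieldK
      letI := T.instNumberFieldK; letI := T.instAlgebraK; letI := T.instFieldFbar; letI := T.instAlgebraFbar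
      letI := T.instAlgebraKFbar; letI := T.instIsElliptic
      exact licenceOn_sigmaReachMix_chosen T.D (M P l T) (archPk P l T) (archSub P l T) (Ψ P l T) (act P l T) (Mmod P l T) (region P l T)
          (n P l T) (lat P l T) (sig P l T) (split P l T) (qData P l T))
    hMu20₁ h0 h2

/-! ## §E3. Row 15's mass binders IMPLY row 20′'s (the Σ₂₀′ instance is the stronger theorem, binder by binder) -/
/-- **[MU-C at Σ₁₅] ⟹ [MU-C at Σ₂₀′].** On the content locus, row 15's mass binder of p487290 §2 («SOME certified dictionary's slot-reach window retains
`≥ μ₀·gap − Tol`») implies row 20′'s, datum by datum (§E1 + `offSigmaTolerance_mono`); so p487290's `abcExpOn_farFromCusps_of_mu_sigma15_content_hregC` is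
`abcExpOn_farFromCusps_of_mu_sigma20_content_hregC ∘` this lemma. Both binders are HYPOTHESES; no side taken. [claim: Mochizuki2012, status: disputed] -/
theorem hMu20_of_hMu15_content {μ₀ : ℝ}
    (hMu15 : ∀ P : NFPoint, P ∈ UP → ∀ l : ℕ, l.Prime → 5 ≤ l →
      Cor22.AdmitsCore P → Cor22.CondP2 P l → Cor22.CondP5 P l → Cor22.CondP6 P l →
      6 * ((1 + 20 * (Cor22.dmod P : ℝ) / l) * (P.logDiff + Cor22.logCondAvoid P {2, l}))
          + 120 * (2 ^ 12 * 3 ^ 3 * 5 * (Cor22.dmod P : ℝ) * l) < Cor22.logQAvoid P {2, l} →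
      ∀ T : Cor22.ThetaVolumeDatumAt P l, letI := T.instFieldF; letI := T.instNumberFieldF; letI := T.instAlgebraF; letI := T.instFieldK;
        letI := T.instNumberFieldK; letI := T.instAlgebraK; letI := T.instFieldFbar; letI := T.instAlgebraFbar;
        letI := T.instAlgebraKFbar; letI := T.instIsElliptic;
      ∃ (n₀ : ∀ pp : Nat.Primes, (thetaIndex (pilotDataOfK T.D T.K)).Fibre (.inr pp) → ℕ)
        (lam : ∀ pp : Nat.Primes, (thetaIndex (pilotDataOfK T.D T.K)).Fibre (.inr pp) → ℝ)
        (mq : ∀ pp : Nat.Primes, (thetaIndex (pilotDataOfK T.D T.K)).Fibre (.inr pp) → ℤ),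
        (∀ (pp : Nat.Primes) (x : (thetaIndex (pilotDataOfK T.D T.K)).Fibre (.inr pp)), haveI : Fact (pp : ℕ).Prime := ⟨pp.2⟩;
          ∃ u : kOf (pilotDataOfK T.D T.K) pp.1 x,
            ‖u‖ ≤ (pp : ℝ) ^ (-(((n₀ pp x : ℤ) - 1 : ℤ) : ℝ) / (ramIdx T.K (placeOf (pilotDataOfK T.D T.K) pp.1 x) : ℝ)) ∧
              u ∉ (logUnits (kOf (pilotDataOfK T.D T.K) pp.1 x) : Set (kOf (pilotDataOfK T.D T.K) pp.1 x))) ∧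
        (∀ (pp : Nat.Primes) (x : (thetaIndex (pilotDataOfK T.D T.K)).Fibre (.inr pp)), haveI : Fact (pp : ℕ).Prime := ⟨pp.2⟩;
          ∃ z ∈ (logUnits (kOf (pilotDataOfK T.D T.K) pp.1 x) : Set (kOf (pilotDataOfK T.D T.K) pp.1 x)), (pp : ℝ) ^ (lam pp x) ≤ ‖z‖) ∧
        (∀ (pp : Nat.Primes) (w : (thetaIndex (pilotDataOfK T.D T.K)).Fibre (.inr pp)), haveI : Fact (pp : ℕ).Prime := ⟨pp.2⟩;
          placeOf (pilotDataOfK T.D T.K) pp.1 w ∈ (pilotDataOfK T.D T.K).S →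
            (mq pp w : ℝ) = (pilotDataOfK T.D T.K).qPilot (placeOf (pilotDataOfK T.D T.K) pp.1 w)) ∧
        OffSigmaTolerance (1 - μ₀) (tol P l) T
          (offTrivialMass
            (settingPrVolSharp (pilotDataOfK T.D T.K) (logvAnalytic_analyticLogv (F := T.K)) (M P l T) (archPk P l T) (archSub P l T) (Ψ P l T)
            (act P l T) (Mmod P l T) (region P l T) (n P l T) (lat P l T) (sig P l T) (split P l T) (qData P l T)
            (exists_realising_qIdeles_pilotDataOfK T.D).choose
            (exists_realising_thetaIdeles_pilotDataOfK T.D).choose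
            (exists_realising_qIdeles_pilotDataOfK T.D).choose_spec.1
            (exists_realising_qIdeles_pilotDataOfK T.D).choose_spec.2.1)
            (sigmaSlotReach (pilotDataOfK T.D T.K)
              (fun pp x => haveI : Fact (pp : ℕ).Prime := ⟨pp.2⟩; ramIdx T.K (placeOf (pilotDataOfK T.D T.K) pp.1 x)) n₀ lam
              (fun pp i w => ((((i : ℕ) : ℤ) + 1) ^ 2) * mq pp w) mq))) :
    ∀ P : NFPoint, P ∈ UP → ∀ l : ℕ, l.Prime → 5 ≤ l →
      Cor22.AdmitsCore P → Cor22.CondP2 P l → Cor22.CondP5 P l → Cor22.CondP6 P l →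
      6 * ((1 + 20 * (Cor22.dmod P : ℝ) / l) * (P.logDiff + Cor22.logCondAvoid P {2, l}))
          + 120 * (2 ^ 12 * 3 ^ 3 * 5 * (Cor22.dmod P : ℝ) * l) < Cor22.logQAvoid P {2, l} →
      ∀ T : Cor22.ThetaVolumeDatumAt P l, letI := T.instFieldF; letI := T.instNumberFieldF; letI := T.instAlgebraF; letI := T.instFieldK;
        letI := T.instNumberFieldK; letI := T.instAlgebraK; letI := T.instFieldFbar; letI := T.instAlgebraFbar;
        letI := T.instAlgebraKFbar; letI := T.instIsElliptic;
      OffSigmaTolerance (1 - μ₀) (tol P l) T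
        (offTrivialMass
          (settingPrVolSharp (pilotDataOfK T.D T.K) (logvAnalytic_analyticLogv (F := T.K)) (M P l T) (archPk P l T) (archSub P l T) (Ψ P l T)
          (act P l T) (Mmod P l T) (region P l T) (n P l T) (lat P l T) (sig P l T) (split P l T) (qData P l T)
          (exists_realising_qIdeles_pilotDataOfK T.D).choose
          (exists_realising_thetaIdeles_pilotDataOfK T.D).choose
          (exists_realising_qIdeles_pilotDataOfK T.D).choose_spec.1
          (exists_realising_qIdeles_pilotDataOfK T.D).choose_spec.2.1)
          (sigmaReachMix (pilotDataOfK T.D T.K))) := by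
  intro P hP l hl h5 hcore hP2 hP5 hP6 hg T
  letI := T.instFieldF; letI := T.instNumberFieldF; letI := T.instAlgebraF; letI := T.instFieldK
  letI := T.instNumberFieldK; letI := T.instAlgebraK; letI := T.instFieldFbar; letI := T.instAlgebraFbar
  letI := T.instAlgebraKFbar; letI := T.instIsElliptic
  obtain ⟨n₀, lam, mq, hn₀, hlam, hmq, hMu⟩ := hMu15 P hP l hl h5 hcore hP2 hP5 hP6 hg T
  exact offSigmaTolerance_mono T
    (offTrivialMass_sigmaReachMix_le_sigmaSlotReach_chosen T.D (M P l T) (archPk P l T) (archSub P l T) (Ψ P l T) (act P l T) (Mmod P l T) (region P l T)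
          (n P l T) (lat P l T) (sig P l T) (split P l T) (qData P l T) n₀ lam mq hn₀ hlam hmq)
    hMu

/-- **[MU₁-bad at Σ₁₅] ⟹ [MU₁-bad at Σ₂₀′]** (Szpiro-bad admissible RATIONAL data): cone-free twin of `hMu20_of_hMu15_content`. [claim: Mochizuki2012, status: disputed] -/
theorem hMu20_of_hMu15_szpiroBad_degOne {μ₀ : ℝ}
    (hMu15₁ : ∀ P : NFPoint, P ∈ UP → P.degree ≤ 1 → ∀ l : ℕ, l.Prime → 5 ≤ l →
      Cor22.AdmitsCore P → Cor22.CondP2 P l → Cor22.CondP5 P l → Cor22.CondP6 P l →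
      (((l : ℝ) + 5) / 4 < (Cor22.dmod P : ℝ) ∨
        6 * l * (((l : ℝ) + 5) - 4 * Cor22.dmod P) / (((l : ℝ) + 4) * ((l : ℝ) - 3))
            * (P.logDiff + (1 - 1 / (l : ℝ)) * Cor22.logCondAvoid P {2, l})
          + 6 * l * ((l : ℝ) + 5) / (((l : ℝ) + 4) * ((l : ℝ) - 3)) * Real.log Real.pi < Cor22.logQAvoid P {2, l}) →
      ∀ T : Cor22.ThetaVolumeDatumAt P l, letI := T.instFieldF; letI := T.instNumberFieldF; letI := T.instAlgebraF; letI := T.instFieldK;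
        letI := T.instNumberFieldK; letI := T.instAlgebraK; letI := T.instFieldFbar; letI := T.instAlgebraFbar;
        letI := T.instAlgebraKFbar; letI := T.instIsElliptic;
      ∃ (n₀ : ∀ pp : Nat.Primes, (thetaIndex (pilotDataOfK T.D T.K)).Fibre (.inr pp) → ℕ)
        (lam : ∀ pp : Nat.Primes, (thetaIndex (pilotDataOfK T.D T.K)).Fibre (.inr pp) → ℝ)
        (mq : ∀ pp : Nat.Primes, (thetaIndex (pilotDataOfK T.D T.K)).Fibre (.inr pp) → ℤ),
        (∀ (pp : Nat.Primes) (x : (thetaIndex (pilotDataOfK T.D T.K)).Fibre (.inr pp)), haveI : Fact (pp : ℕ).Prime := ⟨pp.2⟩;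
          ∃ u : kOf (pilotDataOfK T.D T.K) pp.1 x,
            ‖u‖ ≤ (pp : ℝ) ^ (-(((n₀ pp x : ℤ) - 1 : ℤ) : ℝ) / (ramIdx T.K (placeOf (pilotDataOfK T.D T.K) pp.1 x) : ℝ)) ∧
              u ∉ (logUnits (kOf (pilotDataOfK T.D T.K) pp.1 x) : Set (kOf (pilotDataOfK T.D T.K) pp.1 x))) ∧
        (∀ (pp : Nat.Primes) (x : (thetaIndex (pilotDataOfK T.D T.K)).Fibre (.inr pp)), haveI : Fact (pp : ℕ).Prime := ⟨pp.2⟩;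
          ∃ z ∈ (logUnits (kOf (pilotDataOfK T.D T.K) pp.1 x) : Set (kOf (pilotDataOfK T.D T.K) pp.1 x)), (pp : ℝ) ^ (lam pp x) ≤ ‖z‖) ∧
        (∀ (pp : Nat.Primes) (w : (thetaIndex (pilotDataOfK T.D T.K)).Fibre (.inr pp)), haveI : Fact (pp : ℕ).Prime := ⟨pp.2⟩;
          placeOf (pilotDataOfK T.D T.K) pp.1 w ∈ (pilotDataOfK T.D T.K).S →
            (mq pp w : ℝ) = (pilotDataOfK T.D T.K).qPilot (placeOf (pilotDataOfK T.D T.K) pp.1 w)) ∧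
        OffSigmaTolerance (1 - μ₀) (tol P l) T
          (offTrivialMass
            (settingPrVolSharp (pilotDataOfK T.D T.K) (logvAnalytic_analyticLogv (F := T.K)) (M P l T) (archPk P l T) (archSub P l T) (Ψ P l T)
            (act P l T) (Mmod P l T) (region P l T) (n P l T) (lat P l T) (sig P l T) (split P l T) (qData P l T)
            (exists_realising_qIdeles_pilotDataOfK T.D).choose
            (exists_realising_thetaIdeles_pilotDataOfK T.D).choose
            (exists_realising_qIdeles_pilotDataOfK T.D).choose_spec.1
            (exists_realising_qIdeles_pilotDataOfK T.D).choose_spec.2.1)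
            (sigmaSlotReach (pilotDataOfK T.D T.K)
              (fun pp x => haveI : Fact (pp : ℕ).Prime := ⟨pp.2⟩; ramIdx T.K (placeOf (pilotDataOfK T.D T.K) pp.1 x)) n₀ lam
              (fun pp i w => ((((i : ℕ) : ℤ) + 1) ^ 2) * mq pp w) mq))) :
    ∀ P : NFPoint, P ∈ UP → P.degree ≤ 1 → ∀ l : ℕ, l.Prime → 5 ≤ l →
      Cor22.AdmitsCore P → Cor22.CondP2 P l → Cor22.CondP5 P l → Cor22.CondP6 P l →
      (((l : ℝ) + 5) / 4 < (Cor22.dmod P : ℝ) ∨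
        6 * l * (((l : ℝ) + 5) - 4 * Cor22.dmod P) / (((l : ℝ) + 4) * ((l : ℝ) - 3))
            * (P.logDiff + (1 - 1 / (l : ℝ)) * Cor22.logCondAvoid P {2, l})
          + 6 * l * ((l : ℝ) + 5) / (((l : ℝ) + 4) * ((l : ℝ) - 3)) * Real.log Real.pi < Cor22.logQAvoid P {2, l}) →
      ∀ T : Cor22.ThetaVolumeDatumAt P l, letI := T.instFieldF; letI := T.instNumberFieldF; letI := T.instAlgebraF; letI := T.instFieldK;
        letI := T.instNumberFieldK; letI := T.instAlgebraK; letI := T.instFieldFbar; letI := T.instAlgebraFbar;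
        letI := T.instAlgebraKFbar; letI := T.instIsElliptic;
      OffSigmaTolerance (1 - μ₀) (tol P l) T
        (offTrivialMass
          (settingPrVolSharp (pilotDataOfK T.D T.K) (logvAnalytic_analyticLogv (F := T.K)) (M P l T) (archPk P l T) (archSub P l T) (Ψ P l T)
          (act P l T) (Mmod P l T) (region P l T) (n P l T) (lat P l T) (sig P l T) (split P l T) (qData P l T)
          (exists_realising_qIdeles_pilotDataOfK T.D).choose
          (exists_realising_thetaIdeles_pilotDataOfK T.D).choose
          (exists_realising_qIdeles_pilotDataOfK T.D).choose_spec.1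
          (exists_realising_qIdeles_pilotDataOfK T.D).choose_spec.2.1)
          (sigmaReachMix (pilotDataOfK T.D T.K))) := by
  intro P hP hdeg l hl h5 hcore hP2 hP5 hP6 hbad T
  letI := T.instFieldF; letI := T.instNumberFieldF; letI := T.instAlgebraF; letI := T.instFieldK
  letI := T.instNumberFieldK; letI := T.instAlgebraK; letI := T.instFieldFbar; letI := T.instAlgebraFbar
  letI := T.instAlgebraKFbar; letI := T.instIsElliptic
  obtain ⟨n₀, lam, mq, hn₀, hlam, hmq, hMu⟩ := hMu15₁ P hP hdeg l hl h5 hcore hP2 hP5 hP6 hbad T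
  exact offSigmaTolerance_mono T
    (offTrivialMass_sigmaReachMix_le_sigmaSlotReach_chosen T.D (M P l T) (archPk P l T) (archSub P l T) (Ψ P l T) (act P l T) (Mmod P l T) (region P l T)
          (n P l T) (lat P l T) (sig P l T) (split P l T) (qData P l T) n₀ lam mq hn₀ hlam hmq)
    hMu

end Rows
end Summit.ABC.IUTFork.Repair.RH.LinearReachLaw

end
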